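import Summits.FinalStateConjecture.FinalStateConjecture.Theorems.EIHFluxBalanceInertialRecessionStubSlavingCOERMomSlot

/-!
# Route EIHFluxBalance — `InertialRecession` (E′), line `SketchCleanExcision`, skeleton r13,
# stub `stub_momRowLinear` (ML), part 1: the momentum-row formula — the rows `Ric(♯n, ker n)`
# see the normal jets only through the LINEAR part of the curvature change

Helper file for the crux `stmt-FinalStateConjecture-17403`
(`Summit.FinalStateConjecture.FinalStateConjecture.Theses.EIHFluxBalance.InertialRecession`, E′),
line `SketchCleanExcision`, registered stub `stub_momRowLinear` (ML) of skeleton r13.  Two metric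
component fields `G, G'` on an open `V ∋ x` with `G' x = G x`, `DG'(x) = DG(x) + n ⊗ A`,
`D²G'(x)(v) = D²G(x)(v) + n(v) P + n ⊗ P(v) + n(v) n ⊗ W` (two painted metrics with different
normal jets, `n = dx⁰`).  The exact formula `riemAt_apply_eq_add_of_jet₁` (…COERMomSlot) for
`R'(X,Y)Z − R(X,Y)Z` is of degree two in `A`; the mixed Ricci components `Ric(♯n, e)`, `n(e) = 0`
(the momentum-constraint rows `G⁰ⱼ`) nevertheless depend only on its part LINEAR in `(A, P)`:

* `momRow_sum_coord_jetW_eq_zero` — (pure algebra, any index raising `S`) the basis trace over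
  `X` of the `W`-part `½ S koszulOp(n(X) n⊗W)(Sn, Z) − (X ↔ Sn)` vanishes for `n(Z) = 0`;
* `momRow_sum_coord_quad_eq_zero` — (pure algebra) **the basis trace over `X` of the
  `A`-quadratic part vanishes** for `S` symmetric (`α(Sβ) = β(Sα)`), `A` symmetric, `n(Z) = 0`:
  pointwise in `X` it is two rank-one maps plus a multiple of `S ∘ A`, and the traces reduce to
  the one scalar identity `n(S A(Z,·)) = A(Sn, Z)`;
* `momRow_riemAt_sub_eq` — the exact curvature change regrouped as linear part + `W`-part +
  quadratic part; `momRow_ricAt_sub_eq_sum` — **the momentum-row formula**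
  `Ric'(♯n, e) − Ric(♯n, e) = Σᵢ bⁱ(Lin_{A,P}(bᵢ, ♯n, e))` (`A` symmetric, `n(e) = 0`);
* `momRow_lin_lincomb`, `momRow_sum_coord_lin_lincomb` — the linear part is linear in `(A, P)`;
  `momRow_apply_sharpAt_comm` (`♯` is symmetric), `momRow_symm_of_jet₁` (`A` is symmetric once
  `n ≠ 0`).

In ADM language: the momentum constraint `G⁰ⱼ = −(DᵢKⁱⱼ − Dⱼ tr K)/N` is affine in
`(∂₀g, ∂∂₀g)` — no `(∂₀g)²`, no `∂₀²g` (contracted Codazzi equation; here by brute expansion of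
O'Neill 1983, Ch. 3, Lemma 3.38 / 3.52).  Pure coordinate tensor algebra
(`Literature.Geometry.Lorentzian.MetricCoord`); no definitions, no named facts, no `sorry`.
-/

set_option linter.dupNamespace false
set_option maxSynthPendingDepth 3

noncomputable section

open Set Function ContinuousLinearMap Literature.Geometry.Lorentzian
  Literature.Geometry.Lorentzian.MetricCoord

namespace Summit.FinalStateConjecture.FinalStateConjecture.Theorems.SublinearIsFree.Slaving

section Algebra

variable {E : Type*} [NormedAddCommGroup E] [NormedSpace ℝ E] {ι : Type*} [Fintype ι]

/-- **The `W`-part of the curvature change has no `(♯n, ker n)` trace.** For any index raising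
`S`, covector `n`, bilinear `W` and `Z` with `n(Z) = 0`:
`Σᵢ bⁱ(½ S koszulOp(n(bᵢ) n⊗W)(Sn, Z) − ½ S koszulOp(n(Sn) n⊗W)(bᵢ, Z)) = 0` — pointwise the
summand is `½(n(Sn) W(bᵢ,Z) − n(bᵢ) W(Sn,Z)) Sn`, a rank-one map with trace
`½(n(Sn) W(Sn,Z) − n(Sn) W(Sn,Z)) = 0` (the second normal derivatives are invisible in the
constraint rows; cf. `ricAt_sharp_ker_eq_of_jet₂_along`). [cite: ONeill1983, Ch. 3, Lemma 3.52] -/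
theorem momRow_sum_coord_jetW_eq_zero (S : (E →L[ℝ] ℝ) →L[ℝ] E) (n : E →L[ℝ] ℝ)
    (W : E →L[ℝ] E →L[ℝ] ℝ) {Z : E} (hZ : n Z = 0) (b : Module.Basis ι ℝ E) :
    ∑ i, b.coord i ((2⁻¹ : ℝ) • S (koszulOp (n (b i) • n.smulRight W) (S n) Z) - (2⁻¹ : ℝ) • S (koszulOp (n (S n) • n.smulRight W) (b i) Z)) = 0 := by
  have hkos : ∀ Y₁ Z₁ : E, koszulOp (n.smulRight W) Y₁ Z₁ = n Y₁ • W Z₁ + n Z₁ • W.flip Y₁ - W Y₁ Z₁ • n := by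
    intro Y₁ Z₁
    ext w
    simp only [koszulOp_apply, ContinuousLinearMap.smulRight_apply, _root_.add_apply,
      _root_.sub_apply, FunLike.coe_smul, Pi.smul_apply,
      ContinuousLinearMap.flip_apply, smul_eq_mul]
    ring
  have hsum : ∀ (φ : E →L[ℝ] ℝ) (v : E), ∑ i, φ (b i) * b.coord i v = φ v := by
    intro φ v
    conv_rhs => rw [← b.sum_repr v]
    rw [map_sum]
    refine Finset.sum_congr rfl fun i _ ↦ ?_
    rw [map_smul, smul_eq_mul, mul_comm, Module.Basis.coord_apply]
  calc _ = ∑ i, b.coord i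
        ((((2⁻¹ : ℝ) • (n (S n) • W.flip Z - W (S n) Z • n)) (b i)) • S n) :=
        Finset.sum_congr rfl fun i _ ↦ by
          congr 1
          simp only [map_smul, FunLike.coe_smul, Pi.smul_apply, hkos, hZ, zero_smul, add_zero,
            map_sub, _root_.sub_apply, ContinuousLinearMap.flip_apply, smul_eq_mul]
          module
    _ = 0 := by
        simp only [map_smul, smul_eq_mul, hsum]
        simp only [FunLike.coe_smul, Pi.smul_apply, _root_.sub_apply,
          ContinuousLinearMap.flip_apply, smul_eq_mul]
        ring

/-- **The `A`-quadratic part of the curvature change has no `(♯n, ker n)` trace** ("the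
momentum constraint is linear in the extrinsic curvature"). For a symmetric index raising `S`
(`α(Sβ) = β(Sα)`), a symmetric bilinear `A`, a covector `n` and `Z` with `n(Z) = 0`, the basis
trace over `X` of the degree-two part of `riemAt_apply_eq_add_of_jet₁` at `(X, Sn, Z)`,
`−½ n(X) S A S dK(Sn,Z) + ½ n(Sn) S A S dK(X,Z) + ½ S dK(X, ½ S dK(Sn,Z)) − ½ S dK(Sn, ½ S dK(X,Z))`
(`dK(a,c) = n(a)A(c,·) + n(c)A(·,a) − A(a,c)n`), vanishes: pointwise in `X` it equals
`¼(A(Sn,Z) − n(SA(Z,·))) n(X) SA(Sn,·) + ¼ n(Sn)(n(SA(Z,·)) − A(Sn,Z)) S A(X,·) + ψ(X) Sn` with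
`ψ(Sn) = 0`, and `n(S A(Z,·)) = A(Sn, Z)` by the two symmetries. [cite: ONeill1983, Ch. 3, Lemma 3.52] -/
theorem momRow_sum_coord_quad_eq_zero (S : (E →L[ℝ] ℝ) →L[ℝ] E)
    (hS : ∀ α β : E →L[ℝ] ℝ, α (S β) = β (S α)) {A : E →L[ℝ] E →L[ℝ] ℝ}
    (hA : ∀ v w : E, A v w = A w v) (n : E →L[ℝ] ℝ) {Z : E} (hZ : n Z = 0)
    (b : Module.Basis ι ℝ E) :
    ∑ i, b.coord i (-((2⁻¹ : ℝ) • (n (b i) • S (A (S (n (S n) • A Z + n Z • A.flip (S n) - A (S n) Z • n))))) + (2⁻¹ : ℝ) • (n (S n) • S (A (S (n (b i) • A Z + n Z • A.flip (b i) - A (b i) Z • n))))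
        + (2⁻¹ : ℝ) • S (n (b i) • A ((2⁻¹ : ℝ) • S (n (S n) • A Z + n Z • A.flip (S n) - A (S n) Z • n)) + n ((2⁻¹ : ℝ) • S (n (S n) • A Z + n Z • A.flip (S n) - A (S n) Z • n)) • A.flip (b i) - A (b i) ((2⁻¹ : ℝ) • S (n (S n) • A Z + n Z • A.flip (S n) - A (S n) Z • n)) • n)
        - (2⁻¹ : ℝ) • S (n (S n) • A ((2⁻¹ : ℝ) • S (n (b i) • A Z + n Z • A.flip (b i) - A (b i) Z • n)) + n ((2⁻¹ : ℝ) • S (n (b i) • A Z + n Z • A.flip (b i) - A (b i) Z • n)) • A.flip (S n) - A (S n) ((2⁻¹ : ℝ) • S (n (b i) • A Z + n Z • A.flip (b i) - A (b i) Z • n)) • n)) = 0 := by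
  have hAf : A.flip = A := by
    ext v w
    exact hA w v
  have hkey : n (S (A Z)) = A (S n) Z := by
    rw [hS]
    exact hA _ _
  have hsum : ∀ (φ : E →L[ℝ] ℝ) (v : E), ∑ i, φ (b i) * b.coord i v = φ v := by
    intro φ v
    conv_rhs => rw [← b.sum_repr v]
    rw [map_sum]
    refine Finset.sum_congr rfl fun i _ ↦ ?_
    rw [map_smul, smul_eq_mul, mul_comm, Module.Basis.coord_apply]
  rw [hAf]
  calc _ = ∑ i, b.coord i
        ((((4⁻¹ * (A (S n) Z - n (S (A Z)))) • n) (b i)) • S (A (S n))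
          + (4⁻¹ * (n (S n) * (n (S (A Z)) - A (S n) Z))) • S (A (b i))
          + (((4⁻¹ : ℝ) • (-(n (S n) • A.flip (S (A Z))) + A (S n) Z • A.flip (S n)
              + A (S n) (S (A Z)) • n - A (S n) (S n) • A.flip Z)) (b i)) • S n) :=
        Finset.sum_congr rfl fun i _ ↦ by
          congr 1
          simp only [map_add, map_sub, map_smul, hZ, zero_smul, add_zero, _root_.add_apply,
            _root_.sub_apply, _root_.neg_apply, FunLike.coe_smul, Pi.smul_apply,
            ContinuousLinearMap.flip_apply, smul_eq_mul]
          module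
    _ = 0 := by
        simp only [map_add, map_smul, smul_eq_mul, Finset.sum_add_distrib, hsum, ← Finset.mul_sum]
        simp only [_root_.add_apply, _root_.sub_apply,
          _root_.neg_apply, FunLike.coe_smul, Pi.smul_apply,
          ContinuousLinearMap.flip_apply, smul_eq_mul]
        rw [hkey]
        ring

end Algebra

section Jet

variable {E : Type*} [NormedAddCommGroup E] [NormedSpace ℝ E] [CompleteSpace E]
  {G G' : E → E →L[ℝ] E →L[ℝ] ℝ} {V : Set E} {x : E} {n : E →L[ℝ] ℝ} {A : E →L[ℝ] E →L[ℝ] ℝ}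

omit [CompleteSpace E] in
/-- **`♯` is symmetric**: `α(♯β) = β(♯α)` for the index raising of a symmetric invertible form
(`G(♯α, ♯β) = α(♯β)` and `= β(♯α)`). [cite: ONeill1983, Ch. 3, p. 60] -/
theorem momRow_apply_sharpAt_comm (hG : IsMetricOn G V) (hx : x ∈ V) (α β : E →L[ℝ] ℝ) :
    α (sharpAt G x β) = β (sharpAt G x α) := by
  have hi := hG.isInvertible x hx
  rw [← apply_sharpAt_apply hi α (sharpAt G x β), apply_apply_sharpAt hi (hG.symm x hx) β]

omit [CompleteSpace E] in
/-- **The first-jet datum is symmetric.** If `DG'(x) = DG(x) + n ⊗ A` for two metric component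
fields and `n(v) ≠ 0` for some `v`, then `A` is symmetric (both `DG(x)(v)` and `DG'(x)(v)` are
symmetric bilinear forms, `IsMetricOn.fderiv_symm`). [folklore] -/
theorem momRow_symm_of_jet₁ (hG : IsMetricOn G V) (hG' : IsMetricOn G' V) (hx : x ∈ V)
    (h1 : fderiv ℝ G' x = fderiv ℝ G x + n.smulRight A) {v : E} (hv : n v ≠ 0) (Y Z : E) :
    A Y Z = A Z Y := by
  have e1 : fderiv ℝ G' x v Y Z = fderiv ℝ G x v Y Z + n v * A Y Z := by
    rw [h1]
    simp only [_root_.add_apply, ContinuousLinearMap.smulRight_apply,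
      FunLike.coe_smul, Pi.smul_apply, smul_eq_mul]
  have e2 : fderiv ℝ G' x v Z Y = fderiv ℝ G x v Z Y + n v * A Z Y := by
    rw [h1]
    simp only [_root_.add_apply, ContinuousLinearMap.smulRight_apply,
      FunLike.coe_smul, Pi.smul_apply, smul_eq_mul]
  rw [hG'.fderiv_symm hx v Y Z, hG.fderiv_symm hx v Y Z, e2] at e1
  exact mul_left_cancel₀ hv (by linarith)

/-- **The curvature change regrouped by degree.** Under the jet hypotheses of
`riemAt_apply_eq_add_of_jet₁` (…COERMomSlot), `R'(X,Y)Z − R(X,Y)Z` is the sum of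
(i) a part linear in `(A, P)`:
`½[D♯(X)dK(Y,Z) − n(X)♯A♯K(Y)Z + ♯koszulOp(n(X)P + n⊗P(X))(Y)(Z)] − (X ↔ Y)`
`+ Γ(X)(½♯dK(Y,Z)) + ½♯dK(X, Γ(Y)Z) − (X ↔ Y)`,
(ii) the `W`-part `½♯koszulOp(n(X) n⊗W)(Y)(Z) − (X ↔ Y)`, and (iii) the `A`-quadratic part
`−½n(X)♯A♯dK(Y,Z) + ½♯dK(X, ½♯dK(Y,Z)) − (X ↔ Y)` (`dK(a,c) = n(a)A(c,·) + n(c)A(·,a) − A(a,c)n`).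
[cite: ONeill1983, Ch. 3, Lemma 3.38] -/
theorem momRow_riemAt_sub_eq (hG : IsMetricOn G V) (hG' : IsMetricOn G' V)
    (hx : x ∈ V) (h0 : G' x = G x) (h1 : fderiv ℝ G' x = fderiv ℝ G x + n.smulRight A)
    {P : E →L[ℝ] E →L[ℝ] E →L[ℝ] ℝ} {W : E →L[ℝ] E →L[ℝ] ℝ}
    (h2 : ∀ v, fderiv ℝ (fderiv ℝ G') x v =
      fderiv ℝ (fderiv ℝ G) x v + (n v • P + n.smulRight (P v) + n v • n.smulRight W))
    (X Y Z : E) :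
    riemAt G' x X Y Z - riemAt G x X Y Z =
      ((2⁻¹ : ℝ) • (fderiv ℝ (sharpAt G) x X (n Y • A Z + n Z • A.flip Y - A Y Z • n) - n X • sharpAt G x (A (sharpAt G x (koszulCLM G x Y Z))) + sharpAt G x (koszulOp (n X • P + n.smulRight (P X)) Y Z))
        - (2⁻¹ : ℝ) • (fderiv ℝ (sharpAt G) x Y (n X • A Z + n Z • A.flip X - A X Z • n) - n Y • sharpAt G x (A (sharpAt G x (koszulCLM G x X Z))) + sharpAt G x (koszulOp (n Y • P + n.smulRight (P Y)) X Z))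
        + (chrAt G x X ((2⁻¹ : ℝ) • sharpAt G x (n Y • A Z + n Z • A.flip Y - A Y Z • n)) + (2⁻¹ : ℝ) • sharpAt G x (n X • A (chrAt G x Y Z) + n (chrAt G x Y Z) • A.flip X - A X (chrAt G x Y Z) • n))
        - (chrAt G x Y ((2⁻¹ : ℝ) • sharpAt G x (n X • A Z + n Z • A.flip X - A X Z • n)) + (2⁻¹ : ℝ) • sharpAt G x (n Y • A (chrAt G x X Z) + n (chrAt G x X Z) • A.flip Y - A Y (chrAt G x X Z) • n)))
      + ((2⁻¹ : ℝ) • sharpAt G x (koszulOp (n X • n.smulRight W) Y Z) - (2⁻¹ : ℝ) • sharpAt G x (koszulOp (n Y • n.smulRight W) X Z))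
      + (-((2⁻¹ : ℝ) • (n X • sharpAt G x (A (sharpAt G x (n Y • A Z + n Z • A.flip Y - A Y Z • n))))) + (2⁻¹ : ℝ) • (n Y • sharpAt G x (A (sharpAt G x (n X • A Z + n Z • A.flip X - A X Z • n))))
        + (2⁻¹ : ℝ) • sharpAt G x (n X • A ((2⁻¹ : ℝ) • sharpAt G x (n Y • A Z + n Z • A.flip Y - A Y Z • n)) + n ((2⁻¹ : ℝ) • sharpAt G x (n Y • A Z + n Z • A.flip Y - A Y Z • n)) • A.flip X - A X ((2⁻¹ : ℝ) • sharpAt G x (n Y • A Z + n Z • A.flip Y - A Y Z • n)) • n)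
        - (2⁻¹ : ℝ) • sharpAt G x (n Y • A ((2⁻¹ : ℝ) • sharpAt G x (n X • A Z + n Z • A.flip X - A X Z • n)) + n ((2⁻¹ : ℝ) • sharpAt G x (n X • A Z + n Z • A.flip X - A X Z • n)) • A.flip Y - A Y ((2⁻¹ : ℝ) • sharpAt G x (n X • A Z + n Z • A.flip X - A X Z • n)) • n)) := by
  rw [riemAt_apply_eq_add_of_jet₁ hG hG' hx h0 h1 h2 X Y Z]
  simp only [map_add, map_sub, map_smul, _root_.add_apply, FunLike.coe_smul, Pi.smul_apply,
    smul_eq_mul]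
  module

/-- **The momentum-row formula.** Under the jet hypotheses of `riemAt_apply_eq_add_of_jet₁`,
with `A` symmetric and `n(e) = 0`: `Ric'(♯n, e) − Ric(♯n, e) = Σᵢ bⁱ(Lin_{A,P}(bᵢ, ♯n, e))` in any
basis — the trace of the LINEAR part of the curvature change only; the `W`-part and the
`A`-quadratic part have vanishing trace (`momRow_sum_coord_jetW_eq_zero`,
`momRow_sum_coord_quad_eq_zero`, `♯` symmetric by `momRow_apply_sharpAt_comm`). The coordinate
form of "the momentum constraint is affine in `(∂₀g, ∂∂₀g)`". [cite: ONeill1983, Ch. 3, Lemma 3.52] -/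
theorem momRow_ricAt_sub_eq_sum [FiniteDimensional ℝ E] {ι : Type*} [Fintype ι]
    (hG : IsMetricOn G V) (hG' : IsMetricOn G' V)
    (hx : x ∈ V) (h0 : G' x = G x) (h1 : fderiv ℝ G' x = fderiv ℝ G x + n.smulRight A)
    {P : E →L[ℝ] E →L[ℝ] E →L[ℝ] ℝ} {W : E →L[ℝ] E →L[ℝ] ℝ}
    (h2 : ∀ v, fderiv ℝ (fderiv ℝ G') x v =
      fderiv ℝ (fderiv ℝ G) x v + (n v • P + n.smulRight (P v) + n v • n.smulRight W))
    (hA : ∀ v w : E, A v w = A w v) {e : E} (he : n e = 0) (b : Module.Basis ι ℝ E) :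
    ricAt G' x (sharpAt G x n) e - ricAt G x (sharpAt G x n) e =
      ∑ i, b.coord i ((2⁻¹ : ℝ) • (fderiv ℝ (sharpAt G) x (b i) (n (sharpAt G x n) • A e + n e • A.flip (sharpAt G x n) - A (sharpAt G x n) e • n) - n (b i) • sharpAt G x (A (sharpAt G x (koszulCLM G x (sharpAt G x n) e))) + sharpAt G x (koszulOp (n (b i) • P + n.smulRight (P (b i))) (sharpAt G x n) e))
        - (2⁻¹ : ℝ) • (fderiv ℝ (sharpAt G) x (sharpAt G x n) (n (b i) • A e + n e • A.flip (b i) - A (b i) e • n) - n (sharpAt G x n) • sharpAt G x (A (sharpAt G x (koszulCLM G x (b i) e))) + sharpAt G x (koszulOp (n (sharpAt G x n) • P + n.smulRight (P (sharpAt G x n))) (b i) e))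
        + (chrAt G x (b i) ((2⁻¹ : ℝ) • sharpAt G x (n (sharpAt G x n) • A e + n e • A.flip (sharpAt G x n) - A (sharpAt G x n) e • n)) + (2⁻¹ : ℝ) • sharpAt G x (n (b i) • A (chrAt G x (sharpAt G x n) e) + n (chrAt G x (sharpAt G x n) e) • A.flip (b i) - A (b i) (chrAt G x (sharpAt G x n) e) • n))
        - (chrAt G x (sharpAt G x n) ((2⁻¹ : ℝ) • sharpAt G x (n (b i) • A e + n e • A.flip (b i) - A (b i) e • n)) + (2⁻¹ : ℝ) • sharpAt G x (n (sharpAt G x n) • A (chrAt G x (b i) e) + n (chrAt G x (b i) e) • A.flip (sharpAt G x n) - A (sharpAt G x n) (chrAt G x (b i) e) • n))) := by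
  have hsplit : ∀ f g h : ι → E, ∑ i, b.coord i (f i + g i + h i) =
      ∑ i, b.coord i (f i) + ∑ i, b.coord i (g i) + ∑ i, b.coord i (h i) := by
    intro f g h
    simp only [map_add, Finset.sum_add_distrib]
  rw [ricAt_sub_eq_sum_coord b]
  simp only [momRow_riemAt_sub_eq hG hG' hx h0 h1 h2]
  rw [hsplit, momRow_sum_coord_jetW_eq_zero (sharpAt G x) n W he b,
    momRow_sum_coord_quad_eq_zero (sharpAt G x) (momRow_apply_sharpAt_comm hG hx) hA n he b,
    add_zero, add_zero]

omit [CompleteSpace E] in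
/-- **The linear part of the curvature change is linear in `(A, P)`** (pointwise in `X, Y, Z`).
[folklore] -/
theorem momRow_lin_lincomb (c₁ c₂ : ℝ) (A₁ A₂ : E →L[ℝ] E →L[ℝ] ℝ)
    (P₁ P₂ : E →L[ℝ] E →L[ℝ] E →L[ℝ] ℝ) (X Y Z : E) :
    ((2⁻¹ : ℝ) • (fderiv ℝ (sharpAt G) x X (n Y • (c₁ • A₁ + c₂ • A₂) Z + n Z • (c₁ • A₁ + c₂ • A₂).flip Y - (c₁ • A₁ + c₂ • A₂) Y Z • n) - n X • sharpAt G x ((c₁ • A₁ + c₂ • A₂) (sharpAt G x (koszulCLM G x Y Z))) + sharpAt G x (koszulOp (n X • (c₁ • P₁ + c₂ • P₂) + n.smulRight ((c₁ • P₁ + c₂ • P₂) X)) Y Z))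
        - (2⁻¹ : ℝ) • (fderiv ℝ (sharpAt G) x Y (n X • (c₁ • A₁ + c₂ • A₂) Z + n Z • (c₁ • A₁ + c₂ • A₂).flip X - (c₁ • A₁ + c₂ • A₂) X Z • n) - n Y • sharpAt G x ((c₁ • A₁ + c₂ • A₂) (sharpAt G x (koszulCLM G x X Z))) + sharpAt G x (koszulOp (n Y • (c₁ • P₁ + c₂ • P₂) + n.smulRight ((c₁ • P₁ + c₂ • P₂) Y)) X Z))
        + (chrAt G x X ((2⁻¹ : ℝ) • sharpAt G x (n Y • (c₁ • A₁ + c₂ • A₂) Z + n Z • (c₁ • A₁ + c₂ • A₂).flip Y - (c₁ • A₁ + c₂ • A₂) Y Z • n)) + (2⁻¹ : ℝ) • sharpAt G x (n X • (c₁ • A₁ + c₂ • A₂) (chrAt G x Y Z) + n (chrAt G x Y Z) • (c₁ • A₁ + c₂ • A₂).flip X - (c₁ • A₁ + c₂ • A₂) X (chrAt G x Y Z) • n))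
        - (chrAt G x Y ((2⁻¹ : ℝ) • sharpAt G x (n X • (c₁ • A₁ + c₂ • A₂) Z + n Z • (c₁ • A₁ + c₂ • A₂).flip X - (c₁ • A₁ + c₂ • A₂) X Z • n)) + (2⁻¹ : ℝ) • sharpAt G x (n Y • (c₁ • A₁ + c₂ • A₂) (chrAt G x X Z) + n (chrAt G x X Z) • (c₁ • A₁ + c₂ • A₂).flip Y - (c₁ • A₁ + c₂ • A₂) Y (chrAt G x X Z) • n)))
    = c₁ • ((2⁻¹ : ℝ) • (fderiv ℝ (sharpAt G) x X (n Y • A₁ Z + n Z • A₁.flip Y - A₁ Y Z • n) - n X • sharpAt G x (A₁ (sharpAt G x (koszulCLM G x Y Z))) + sharpAt G x (koszulOp (n X • P₁ + n.smulRight (P₁ X)) Y Z))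
        - (2⁻¹ : ℝ) • (fderiv ℝ (sharpAt G) x Y (n X • A₁ Z + n Z • A₁.flip X - A₁ X Z • n) - n Y • sharpAt G x (A₁ (sharpAt G x (koszulCLM G x X Z))) + sharpAt G x (koszulOp (n Y • P₁ + n.smulRight (P₁ Y)) X Z))
        + (chrAt G x X ((2⁻¹ : ℝ) • sharpAt G x (n Y • A₁ Z + n Z • A₁.flip Y - A₁ Y Z • n)) + (2⁻¹ : ℝ) • sharpAt G x (n X • A₁ (chrAt G x Y Z) + n (chrAt G x Y Z) • A₁.flip X - A₁ X (chrAt G x Y Z) • n))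
        - (chrAt G x Y ((2⁻¹ : ℝ) • sharpAt G x (n X • A₁ Z + n Z • A₁.flip X - A₁ X Z • n)) + (2⁻¹ : ℝ) • sharpAt G x (n Y • A₁ (chrAt G x X Z) + n (chrAt G x X Z) • A₁.flip Y - A₁ Y (chrAt G x X Z) • n)))
      + c₂ • ((2⁻¹ : ℝ) • (fderiv ℝ (sharpAt G) x X (n Y • A₂ Z + n Z • A₂.flip Y - A₂ Y Z • n) - n X • sharpAt G x (A₂ (sharpAt G x (koszulCLM G x Y Z))) + sharpAt G x (koszulOp (n X • P₂ + n.smulRight (P₂ X)) Y Z))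
        - (2⁻¹ : ℝ) • (fderiv ℝ (sharpAt G) x Y (n X • A₂ Z + n Z • A₂.flip X - A₂ X Z • n) - n Y • sharpAt G x (A₂ (sharpAt G x (koszulCLM G x X Z))) + sharpAt G x (koszulOp (n Y • P₂ + n.smulRight (P₂ Y)) X Z))
        + (chrAt G x X ((2⁻¹ : ℝ) • sharpAt G x (n Y • A₂ Z + n Z • A₂.flip Y - A₂ Y Z • n)) + (2⁻¹ : ℝ) • sharpAt G x (n X • A₂ (chrAt G x Y Z) + n (chrAt G x Y Z) • A₂.flip X - A₂ X (chrAt G x Y Z) • n))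
        - (chrAt G x Y ((2⁻¹ : ℝ) • sharpAt G x (n X • A₂ Z + n Z • A₂.flip X - A₂ X Z • n)) + (2⁻¹ : ℝ) • sharpAt G x (n Y • A₂ (chrAt G x X Z) + n (chrAt G x X Z) • A₂.flip Y - A₂ Y (chrAt G x X Z) • n))) := by
  have hsa : ∀ B₁ B₂ : E →L[ℝ] E →L[ℝ] ℝ, n.smulRight (B₁ + B₂) = n.smulRight B₁ + n.smulRight B₂ := by
    intro B₁ B₂
    ext v w
    simp only [ContinuousLinearMap.smulRight_apply, _root_.add_apply, smul_add]
  have hss : ∀ (c : ℝ) (B : E →L[ℝ] E →L[ℝ] ℝ), n.smulRight (c • B) = c • n.smulRight B := by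
    intro c B
    ext v w
    simp only [ContinuousLinearMap.smulRight_apply, FunLike.coe_smul, Pi.smul_apply,
      smul_eq_mul]
    ring
  simp only [_root_.add_apply, FunLike.coe_smul, Pi.smul_apply, map_add, map_smul, map_sub,
    ContinuousLinearMap.flip_add, ContinuousLinearMap.flip_smul, hsa, hss, smul_eq_mul]
  module

omit [CompleteSpace E] in
/-- **The traced linear part is linear in `(A, P)`** (the form consumed by the momentum-row
linearity). [folklore] -/
theorem momRow_sum_coord_lin_lincomb [FiniteDimensional ℝ E] {ι : Type*} [Fintype ι]
    (b : Module.Basis ι ℝ E) (c₁ c₂ : ℝ) (A₁ A₂ : E →L[ℝ] E →L[ℝ] ℝ)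
    (P₁ P₂ : E →L[ℝ] E →L[ℝ] E →L[ℝ] ℝ) (Y Z : E) :
    ∑ i, b.coord i ((2⁻¹ : ℝ) • (fderiv ℝ (sharpAt G) x (b i) (n Y • (c₁ • A₁ + c₂ • A₂) Z + n Z • (c₁ • A₁ + c₂ • A₂).flip Y - (c₁ • A₁ + c₂ • A₂) Y Z • n) - n (b i) • sharpAt G x ((c₁ • A₁ + c₂ • A₂) (sharpAt G x (koszulCLM G x Y Z))) + sharpAt G x (koszulOp (n (b i) • (c₁ • P₁ + c₂ • P₂) + n.smulRight ((c₁ • P₁ + c₂ • P₂) (b i))) Y Z))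
        - (2⁻¹ : ℝ) • (fderiv ℝ (sharpAt G) x Y (n (b i) • (c₁ • A₁ + c₂ • A₂) Z + n Z • (c₁ • A₁ + c₂ • A₂).flip (b i) - (c₁ • A₁ + c₂ • A₂) (b i) Z • n) - n Y • sharpAt G x ((c₁ • A₁ + c₂ • A₂) (sharpAt G x (koszulCLM G x (b i) Z))) + sharpAt G x (koszulOp (n Y • (c₁ • P₁ + c₂ • P₂) + n.smulRight ((c₁ • P₁ + c₂ • P₂) Y)) (b i) Z))
        + (chrAt G x (b i) ((2⁻¹ : ℝ) • sharpAt G x (n Y • (c₁ • A₁ + c₂ • A₂) Z + n Z • (c₁ • A₁ + c₂ • A₂).flip Y - (c₁ • A₁ + c₂ • A₂) Y Z • n)) + (2⁻¹ : ℝ) • sharpAt G x (n (b i) • (c₁ • A₁ + c₂ • A₂) (chrAt G x Y Z) + n (chrAt G x Y Z) • (c₁ • A₁ + c₂ • A₂).flip (b i) - (c₁ • A₁ + c₂ • A₂) (b i) (chrAt G x Y Z) • n))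
        - (chrAt G x Y ((2⁻¹ : ℝ) • sharpAt G x (n (b i) • (c₁ • A₁ + c₂ • A₂) Z + n Z • (c₁ • A₁ + c₂ • A₂).flip (b i) - (c₁ • A₁ + c₂ • A₂) (b i) Z • n)) + (2⁻¹ : ℝ) • sharpAt G x (n Y • (c₁ • A₁ + c₂ • A₂) (chrAt G x (b i) Z) + n (chrAt G x (b i) Z) • (c₁ • A₁ + c₂ • A₂).flip Y - (c₁ • A₁ + c₂ • A₂) Y (chrAt G x (b i) Z) • n)))
    = c₁ * ∑ i, b.coord i ((2⁻¹ : ℝ) • (fderiv ℝ (sharpAt G) x (b i) (n Y • A₁ Z + n Z • A₁.flip Y - A₁ Y Z • n) - n (b i) • sharpAt G x (A₁ (sharpAt G x (koszulCLM G x Y Z))) + sharpAt G x (koszulOp (n (b i) • P₁ + n.smulRight (P₁ (b i))) Y Z))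
        - (2⁻¹ : ℝ) • (fderiv ℝ (sharpAt G) x Y (n (b i) • A₁ Z + n Z • A₁.flip (b i) - A₁ (b i) Z • n) - n Y • sharpAt G x (A₁ (sharpAt G x (koszulCLM G x (b i) Z))) + sharpAt G x (koszulOp (n Y • P₁ + n.smulRight (P₁ Y)) (b i) Z))
        + (chrAt G x (b i) ((2⁻¹ : ℝ) • sharpAt G x (n Y • A₁ Z + n Z • A₁.flip Y - A₁ Y Z • n)) + (2⁻¹ : ℝ) • sharpAt G x (n (b i) • A₁ (chrAt G x Y Z) + n (chrAt G x Y Z) • A₁.flip (b i) - A₁ (b i) (chrAt G x Y Z) • n))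
        - (chrAt G x Y ((2⁻¹ : ℝ) • sharpAt G x (n (b i) • A₁ Z + n Z • A₁.flip (b i) - A₁ (b i) Z • n)) + (2⁻¹ : ℝ) • sharpAt G x (n Y • A₁ (chrAt G x (b i) Z) + n (chrAt G x (b i) Z) • A₁.flip Y - A₁ Y (chrAt G x (b i) Z) • n)))
      + c₂ * ∑ i, b.coord i ((2⁻¹ : ℝ) • (fderiv ℝ (sharpAt G) x (b i) (n Y • A₂ Z + n Z • A₂.flip Y - A₂ Y Z • n) - n (b i) • sharpAt G x (A₂ (sharpAt G x (koszulCLM G x Y Z))) + sharpAt G x (koszulOp (n (b i) • P₂ + n.smulRight (P₂ (b i))) Y Z))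
        - (2⁻¹ : ℝ) • (fderiv ℝ (sharpAt G) x Y (n (b i) • A₂ Z + n Z • A₂.flip (b i) - A₂ (b i) Z • n) - n Y • sharpAt G x (A₂ (sharpAt G x (koszulCLM G x (b i) Z))) + sharpAt G x (koszulOp (n Y • P₂ + n.smulRight (P₂ Y)) (b i) Z))
        + (chrAt G x (b i) ((2⁻¹ : ℝ) • sharpAt G x (n Y • A₂ Z + n Z • A₂.flip Y - A₂ Y Z • n)) + (2⁻¹ : ℝ) • sharpAt G x (n (b i) • A₂ (chrAt G x Y Z) + n (chrAt G x Y Z) • A₂.flip (b i) - A₂ (b i) (chrAt G x Y Z) • n))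
        - (chrAt G x Y ((2⁻¹ : ℝ) • sharpAt G x (n (b i) • A₂ Z + n Z • A₂.flip (b i) - A₂ (b i) Z • n)) + (2⁻¹ : ℝ) • sharpAt G x (n Y • A₂ (chrAt G x (b i) Z) + n (chrAt G x (b i) Z) • A₂.flip Y - A₂ Y (chrAt G x (b i) Z) • n))) := by
  have hlc : ∀ f g : ι → E, ∑ i, b.coord i (c₁ • f i + c₂ • g i) =
      c₁ * ∑ i, b.coord i (f i) + c₂ * ∑ i, b.coord i (g i) := by
    intro f g
    simp only [map_add, map_smul, smul_eq_mul, Finset.sum_add_distrib, Finset.mul_sum]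
  simp only [momRow_lin_lincomb]
  rw [hlc]

end Jet

/-- **Registered one-line carrier form** (`momRow_ricAt_sub_eq_sum_s0`, the sub-goal of stub ML
served by this file) of the momentum-row formula `momRow_ricAt_sub_eq_sum` on `E4`: for
`n(e) = 0` and `A` symmetric, `Ric'(♯n, e) − Ric(♯n, e)` is the basis trace of the part of the
curvature change LINEAR in `(A, P)` — no `W`, no `A`-quadratic terms (contracted Codazzi
equation in coordinates). [cite: ONeill1983, Ch. 3, Lemma 3.52] -/
theorem momRow_ricAt_sub_eq_sum_s0 : open Literature.Geometry.Lorentzian in ∀ {ι : Type} [Fintype ι] {G G' : E4 → E4 →L[ℝ] E4 →L[ℝ] ℝ} {V : Set E4} {x : E4} {n : E4 →L[ℝ] ℝ} {A : E4 →L[ℝ] E4 →L[ℝ] ℝ} {P : E4 →L[ℝ] E4 →L[ℝ] E4 →L[ℝ] ℝ} {W : E4 →L[ℝ] E4 →L[ℝ] ℝ}, MetricCoord.IsMetricOn G V → MetricCoord.IsMetricOn G' V → x ∈ V → G' x = G x → fderiv ℝ G' x = fderiv ℝ G x + n.smulRight A → (∀ v, fderiv ℝ (fderiv ℝ G') x v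 = fderiv ℝ (fderiv ℝ G) x v + (n v • P + n.smulRight (P v) + n v • n.smulRight W)) → (∀ v w : E4, A v w = A w v) → ∀ {e : E4}, n e = 0 → ∀ b : Module.Basis ι ℝ E4, MetricCoord.ricAt G' x (MetricCoord.sharpAt G x n) e - MetricCoord.ricAt G x (MetricCoord.sharpAt G x n) e = ∑ i, b.coord i ((2⁻¹ : ℝ) • (fderiv ℝ (MetricCoord.sharpAt G) x (b i) (n (MetricCoord.sharpAt G x n) • A e + n e • A.flip (MetricCoord.sharpAt G x n) - A (MetricCoord.sharpAt G x n) e • n) - n (b i) • MetricCoord.sharpAt G x (A (MetricCoord.sharpAt G x (MetricCoord.koszulCLM G x (MetricCoord.sharpAt G x n) e))) + MetricCoord.sharpAt G x (MetricCoord.koszulOp (n (b i) • P + n.smulRight (P (b i))) (MetricCoord.sharpAt G x n) e)) - (2⁻¹ : ℝ) • (fderiv ℝ (MetricCoord.sharpAt G) x (MetricCoord.sharpAt G x n) (n (b i) • A e + n e • A.flip (b i) - A (b i) e • n) - n (MetricCoord.sharpAt G x n) • MetricCoord.sharpAt G x (A (MetricCoord.sharpAt G x (MetricCoord.koszulCLM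 G x (b i) e))) + MetricCoord.sharpAt G x (MetricCoord.koszulOp (n (MetricCoord.sharpAt G x n) • P + n.smulRight (P (MetricCoord.sharpAt G x n))) (b i) e)) + (MetricCoord.chrAt G x (b i) ((2⁻¹ : ℝ) • MetricCoord.sharpAt G x (n (MetricCoord.sharpAt G x n) • A e + n e • A.flip (MetricCoord.sharpAt G x n) - A (MetricCoord.sharpAt G x n) e • n)) + (2⁻¹ : ℝ) • MetricCoord.sharpAt G x (n (b i) • A (MetricCoord.chrAt G x (MetricCoord.sharpAt G x n) e) + n (MetricCoord.chrAt G x (MetricCoord.sharpAt G x n) e) • A.flip (b i) - A (b i) (MetricCoord.chrAt G x (MetricCoord.sharpAt G x n) e) • n)) - (MetricCoord.chrAt G x (MetricCoord.sharpAt G x n) ((2⁻¹ : ℝ) • MetricCoord.sharpAt G x (n (b i) • A e + n e • A.flip (b i) - A (b i) e • n)) + (2⁻¹ : ℝ) • MetricCoord.sharpAt G x (n (MetricCoord.sharpAt G x n) • A (MetricCoord.chrAt G x (b i) e) + n (MetricCoord.chrAt G x (b i) e) • A.flip (MetricCoord.sharpAt G x n) - A (MetricCoord.sharpAt G x n) (MetricCoord.chrAt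 G x (b i) e) • n))) := by
  intro ι _ G G' V x n A P W hG hG' hx h0 h1 h2 hA e he b
  exact momRow_ricAt_sub_eq_sum hG hG' hx h0 h1 h2 hA he b

end Summit.FinalStateConjecture.FinalStateConjecture.Theorems.SublinearIsFree.Slaving
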